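import Literature.AlgebraicGeometry.Resolution.PointBlowupFlagTangentStep
import HarnessLib

/-!
# Hauser–Perlega, Proposition 4 case (i), companion branch `0 < d_res < pᵉ`, and the residual factor under the step

H. Hauser, S. Perlega, *Resolving surface singularities in positive characteristic*, Publ. RIMS Kyoto Univ. **60**
(2024) 767–813 [cite: HauserPerlega2024], §5 p. 783 l. 40–48 ("`s_𝓕 = ord coeff_{(pᵉ−d_𝓕)d_𝓕}(M^{d_𝓕} + G^{pᵉ−d_𝓕})`
if `0 < d_𝓕 < pᵉ`", read as the companion ideal `(M^d) + (G^{pᵉ−d})`, cf. `PointBlowupFlagInvariant`) and Prop. 4 proof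
case (i) (p. 794 l. 36 – p. 795 l. 5): "`F′ = M′·G′`, where `M′(x,y) = x^{d_res−pᵉ}M(x,xy)` and
`G′(x,y) = x^{−d_res}G(x,xy)` … if `0 < d_res < pᵉ`, then
`coeff_{q_𝓖}(M′^{d_𝓖} + G′^{pᵉ−d_𝓖}) = x^{−q_𝓕}·coeff_{q_𝓕}(M^{d_𝓕} + G^{pᵉ−d_𝓕})`, where `q_𝓖 = (pᵉ − d_𝓖)d_𝓖` and
`q_𝓕 = (pᵉ − d_𝓕)d_𝓕`. This proves that `s_𝓖 < s_𝓕`."  Together with Prop. 3's companion branch (p. 792 l. 14–18: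
"`d_res < pᵉ` … `E_a = V(x)` … `s_𝓕 ≤ ord coeff_{(pᵉ−d_res)d_res}(x^{r d_res}) = r d_res((pᵉ − d_res)d_res − 1)!`").

## What is proved (sorry-free; any field `K`; NO new definition, NO named fact)

* Section A — SERIES: cancellation of `x^r` (`X_pow_mul_left_cancel`), `x^r·(C/x^r) = C` (`X_pow_mul_divMonomial`);
  **the residual factor under the step**: from `x^q·C′ = C(x,xy)`, `x^r ∣ C`, `r′ + q = r + d`:
  `x^d·G′ = G(x,xy)` for `G = C/x^r`, `G′ = C′/x^{r′}` (`X_pow_mul_residual_eq_step` — "`G′(x,y) = x^{−d_res}G(x,xy)`"),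
  hence `x^{dk}·G′^k = G^k(x,xy)` (`X_pow_mul_residual_pow_eq_step`); the BARE ROW LAW relative to `x^0` with any
  shift `c` (`inf_rows_add_factorial_of_step'`: `x^c·T = S(x,xy)` and `ord S ≥ c` give `s_c(T) + c! = s_c(S)`); the rows
  of a monomial `x^m` (`inf_rows_monomial_single`: `s_c(x^m) = (c!/c)·m`); the companion arithmetic
  (`companion_monomial_add_factorial`: `(c!/c)·r′d + c! = (c!/c)·rd` for `c = (q−d)d`, `r′ + q = r + d`); and **the
  companion branch of case (i)**: `min(s_c(M′^d), s_c(G′^{q−d})) + c! = min(s_c(M^d), s_c(G^{q−d}))`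
  (`companion_min_add_factorial_of_step`).  Also the row law relative to a two-letter exceptional monomial
  `x^{r_x}y^{r_y}` without shift (`coeff_step_row_xy`: "`E_a = V(xy)`", flags `h = 0`).
* Section B — TYPED (`PointBlowupFlagInvariant`, `E = {x}`, `0 < d_res < pᵉ`): the companion unfolding of `sValue`
  (`sValue_eq_min_of_lt`), the bound `s_𝓕 ≤ (c!/c)·(d_res·r)` (`sValue_le_of_lt`), and **Proposition 3's
  `s`-component in the companion branch** (`exists_isGreatest_sValue_of_lt`: a case-(i) flag with greatest, finite
  `sValue` exists — no Lemma 3 needed, as printed).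

## What is NOT proved here

The typed corollary of the companion drop on `PointBlowup.step` (needs the atlas's exceptional-letter bookkeeping
`excLetters (step …)`, `excExponent`); cases (ii)–(iv).

Provenance: seat res-D-pv-058 acting as res-L1-w43-stub-6 (cell res-hironaka, chain W4.3), 2026-08-27; a Literature
transcription of a PRINTED, refereed proposition in the tree's polynomial/power-series model — not a statement about
any manuscript under adjudication.
-/

noncomputable section

open MvPolynomial Finset
open scoped BigOperators

namespace Literature.AlgebraicGeometry.Resolution

open Literature.AlgebraicGeometry.Resolution.Hauser2010
open Literature.AlgebraicGeometry.Resolution.PointBlowup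
open Literature.AlgebraicGeometry.Resolution.HauserWagner2014

namespace HauserPerlega2024

/-! ## A. Series: the residual factor and its powers under the monomial step -/

section SeriesCompanion

variable {σ : Type*} {K : Type*} [Field K]

/-- the exponent `x^a y^b` evaluated at `x`. [folklore] -/
private theorem sa_l {x y : σ} (hxy : x ≠ y) (a b : ℕ) : (Finsupp.single x a + Finsupp.single y b) x = a := by
  classical
  rw [Finsupp.add_apply, Finsupp.single_eq_same, Finsupp.single_apply, if_neg (Ne.symm hxy), add_zero]

/-- the exponent `x^a y^b` evaluated at `y`. [folklore] -/
private theorem sa_r {x y : σ} (hxy : x ≠ y) (a b : ℕ) : (Finsupp.single x a + Finsupp.single y b) y = b := by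
  classical
  rw [Finsupp.add_apply, Finsupp.single_eq_same, Finsupp.single_apply, if_neg hxy, zero_add]

/-- two letters: an exponent is determined by its two entries. [folklore] -/
private theorem fe2 {x y : σ} (hσ : ∀ l, l = x ∨ l = y) {d d' : σ →₀ ℕ} (hx : d x = d' x) (hy : d y = d' y) :
    d = d' := by
  ext l
  rcases hσ l with rfl | rfl
  · exact hx
  · exact hy

/-- two letters: a sum over all letters has two terms. [folklore] -/
private theorem sum2 {M : Type*} [AddCommMonoid M] [Fintype σ] {x y : σ} (hxy : x ≠ y)
    (hσ : ∀ l, l = x ∨ l = y) (f : σ → M) : ∑ l, f l = f x + f y := by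
  classical
  have huniv : (Finset.univ : Finset σ) = {x, y} := by
    ext l
    simp only [Finset.mem_univ, Finset.mem_insert, Finset.mem_singleton, true_iff]
    exact hσ l
  rw [huniv, Finset.sum_pair hxy]

/-- unfolding the division by a monomial. [folklore] -/
private theorem coeff_divMonomial'' (m d : σ →₀ ℕ) (H : MvPowerSeries σ K) :
    MvPowerSeries.coeff d (divMonomial m H) = MvPowerSeries.coeff (d + m) H := rfl

/-- **cancellation of `x^r`**: `x^r·A = x^r·B ⇒ A = B` (compare the coefficients of `x^{m_x + r} y^{m_y}`) — the division
"`G′(x,y) = x^{−d_res}G(x,xy)`" is well defined. [cite: HauserPerlega2024, Prop. 4 proof case (i) p. 794 l. 38–40] -/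
theorem X_pow_mul_left_cancel (x : σ) (r : ℕ) {A B : MvPowerSeries σ K}
    (h : (MvPowerSeries.X x : MvPowerSeries σ K) ^ r * A = (MvPowerSeries.X x : MvPowerSeries σ K) ^ r * B) :
    A = B := by
  classical
  ext m
  have key : ∀ D : MvPowerSeries σ K,
      MvPowerSeries.coeff (m + Finsupp.single x r) ((MvPowerSeries.X x : MvPowerSeries σ K) ^ r * D) =
        MvPowerSeries.coeff m D := fun D => by
    rw [MvPowerSeries.X_pow_eq, MvPowerSeries.coeff_monomial_mul, if_pos le_add_self, one_mul, add_tsub_cancel_right]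
  have h1 := congrArg (MvPowerSeries.coeff (m + Finsupp.single x r)) h
  rw [key, key] at h1
  exact h1

/-- **`x^r·(C/x^r) = C`** when `x^r ∣ C` (every monomial of `C` has `x`-exponent `≥ r`). [cite: HauserPerlega2024, §4 p. 776 (F = M·G)] -/
theorem X_pow_mul_divMonomial (x : σ) (r : ℕ) (C : MvPowerSeries σ K)
    (hxr : ∀ m, MvPowerSeries.coeff m C ≠ 0 → r ≤ m x) :
    (MvPowerSeries.X x : MvPowerSeries σ K) ^ r * divMonomial (Finsupp.single x r) C = C := by
  classical
  ext m
  rw [MvPowerSeries.X_pow_eq, MvPowerSeries.coeff_monomial_mul]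
  split_ifs with hle
  · rw [one_mul, coeff_divMonomial'', tsub_add_cancel_of_le hle]
  · by_contra hne
    apply hle
    rw [Finsupp.single_le_iff]
    exact hxr m (Ne.symm hne)

variable [Fintype σ] [DecidableEq σ]

/-- **"`G′(x,y) = x^{−d_res}G(x,xy)`"**: from `x^q·C′ = C(x,xy)` (the step on the cleaned expansions), `x^r ∣ C`,
`x^{r′} ∣ C′` and `r′ + q = r + d` ("`M′(x,y) = x^{d_res−pᵉ}M(x,xy)`"), the residual factors `G = C/x^r`, `G′ = C′/x^{r′}`
satisfy `x^d·G′ = G(x,xy)`. [cite: HauserPerlega2024, Prop. 4 proof case (i) p. 794 l. 36–40] -/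
theorem X_pow_mul_residual_eq_step (q : ℕ) (x y : σ) (hxy : x ≠ y) (C C' : MvPowerSeries σ K)
    (hC' : (MvPowerSeries.X x : MvPowerSeries σ K) ^ q * C' = MvPowerSeries.subst (fun l => if l = y then (MvPowerSeries.X x : MvPowerSeries σ K) * MvPowerSeries.X y
        else MvPowerSeries.X l) C)
    (r r' d : ℕ) (hr' : r' + q = r + d) (hxr : ∀ m, MvPowerSeries.coeff m C ≠ 0 → r ≤ m x)
    (hxr' : ∀ m, MvPowerSeries.coeff m C' ≠ 0 → r' ≤ m x) :
    (MvPowerSeries.X x : MvPowerSeries σ K) ^ d * divMonomial (Finsupp.single x r') C' =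
      MvPowerSeries.subst (fun l => if l = y then (MvPowerSeries.X x : MvPowerSeries σ K) * MvPowerSeries.X y
        else MvPowerSeries.X l) (divMonomial (Finsupp.single x r) C) := by
  have hst := hasSubst_step (K := K) x y
  apply X_pow_mul_left_cancel x r
  rw [← mul_assoc, ← pow_add, show r + d = q + r' by omega, pow_add, mul_assoc, X_pow_mul_divMonomial x r' C' hxr', hC',
    ← X_pow_mul_divMonomial x r C hxr, MvPowerSeries.subst_mul hst, MvPowerSeries.subst_pow hst, MvPowerSeries.subst_X hst,
    if_neg hxy, X_pow_mul_divMonomial x r C hxr]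

/-- powers of the residual factor: `x^{dk}·G′^k = G^k(x,xy)`. [cite: HauserPerlega2024, Prop. 4 proof case (i) p. 795 l. 1–4 (G′^{pᵉ−d})] -/
theorem X_pow_mul_pow_eq_step_pow (x y : σ) (G G' : MvPowerSeries σ K) (d k : ℕ)
    (hG' : (MvPowerSeries.X x : MvPowerSeries σ K) ^ d * G' = MvPowerSeries.subst (fun l => if l = y then (MvPowerSeries.X x : MvPowerSeries σ K) * MvPowerSeries.X y
        else MvPowerSeries.X l) G) :
    (MvPowerSeries.X x : MvPowerSeries σ K) ^ (d * k) * G' ^ k = MvPowerSeries.subst (fun l => if l = y then (MvPowerSeries.X x : MvPowerSeries σ K) * MvPowerSeries.X y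
        else MvPowerSeries.X l) (G ^ k) := by
  have hst := hasSubst_step (K := K) x y
  rw [pow_mul, ← mul_pow, hG', MvPowerSeries.subst_pow hst]

/-- **the bare row law relative to `x^0`**: under `x^c·T = S(x,xy)` with all monomials of `S` of degree `≥ c`, the rows
of `T` are the rows of `S` shifted down by `c − i`, so `s_c(T) + c! = s_c(S)` — used with `c = (pᵉ − d)d`, `S = G^{pᵉ−d}`,
`T = G′^{pᵉ−d}` ("`coeff_{q_𝓖}(… G′^{pᵉ−d}) = x^{−q_𝓕}·coeff_{q_𝓕}(… G^{pᵉ−d})`").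
[cite: HauserPerlega2024, Prop. 4 proof case (i) p. 795 l. 1–5] -/
theorem inf_rows_add_factorial_of_step' (c : ℕ) (x y : σ) (hxy : x ≠ y) (hσ : ∀ l, l = x ∨ l = y)
    (S T : MvPowerSeries σ K)
    (hT : (MvPowerSeries.X x : MvPowerSeries σ K) ^ c * T = MvPowerSeries.subst (fun l => if l = y then (MvPowerSeries.X x : MvPowerSeries σ K) * MvPowerSeries.X y
        else MvPowerSeries.X l) S)
    (hmin : ∀ m, MvPowerSeries.coeff m S ≠ 0 → c ≤ m x + m y) (RS RT : ℕ → PowerSeries K)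
    (hRS : ∀ j v, PowerSeries.coeff v (RS j) = MvPowerSeries.coeff (Finsupp.single x v + Finsupp.single y j) S)
    (hRT : ∀ j v, PowerSeries.coeff v (RT j) = MvPowerSeries.coeff (Finsupp.single x v + Finsupp.single y j) T) :
    (Finset.range c).inf (fun i => ((c.factorial / (c - i) : ℕ) : ℕ∞) * (RT i).order) + (c.factorial : ℕ∞) =
      (Finset.range c).inf (fun i => ((c.factorial / (c - i) : ℕ) : ℕ∞) * (RS i).order) := by
  refine inf_rows_add_factorial_eq_of_step RS RT (fun i hi a => ?_) (fun i a hne => ?_)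
  · rw [hRT, hRS, coeff_eq_of_step c x y hxy hσ S T hT, sa_l hxy, sa_r hxy, if_pos (by omega)]
    congr 2
    apply fe2 hσ
    · rw [sa_l hxy, sa_l hxy]; omega
    · rw [sa_r hxy, sa_r hxy]
  · rw [hRS] at hne
    have := hmin _ hne
    rw [sa_l hxy, sa_r hxy] at this
    omega

omit [Fintype σ] [DecidableEq σ] in
/-- **the rows of a monomial `x^m`**: `s_c(x^m) = (c!/c)·m` (`c ≥ 1`: only row `0` is non-zero, of order `m`) — "`s_𝓕 ≤
ord coeff_{(pᵉ−d_res)d_res}(x^{r d_res}) = r d_res ((pᵉ − d_res)d_res − 1)!`".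
[cite: HauserPerlega2024, Prop. 3 proof p. 792 l. 16–18] -/
theorem inf_rows_monomial_single (c m : ℕ) (hc : 1 ≤ c) (x y : σ) (hxy : x ≠ y) (hσ : ∀ l, l = x ∨ l = y)
    (R : ℕ → PowerSeries K)
    (hR : ∀ j v, PowerSeries.coeff v (R j) = MvPowerSeries.coeff (Finsupp.single x v + Finsupp.single y j)
      (MvPowerSeries.monomial (Finsupp.single x m) (1 : K))) :
    (Finset.range c).inf (fun i => ((c.factorial / (c - i) : ℕ) : ℕ∞) * (R i).order) = ((c.factorial / c * m : ℕ) : ℕ∞) := by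
  classical
  have hR0 : R 0 = PowerSeries.monomial m (1 : K) := by
    ext v
    rw [hR, PowerSeries.coeff_monomial, MvPowerSeries.coeff_monomial]
    have : (Finsupp.single x v + Finsupp.single y 0 = Finsupp.single x m) ↔ v = m := by
      constructor
      · intro h; have := congrArg (fun f : σ →₀ ℕ => f x) h; simpa [sa_l hxy] using this
      · intro h; apply fe2 hσ
        · rw [sa_l hxy, Finsupp.single_eq_same, h]
        · rw [sa_r hxy, Finsupp.single_apply, if_neg hxy]
    simp only [this]
  have hRj : ∀ j, 1 ≤ j → R j = 0 := by
    intro j hj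
    ext v
    rw [hR, MvPowerSeries.coeff_monomial, map_zero, if_neg]
    intro h
    have := congrArg (fun f : σ →₀ ℕ => f y) h
    simp only [sa_r hxy, Finsupp.single_apply, if_neg hxy] at this
    omega
  apply le_antisymm
  · calc (Finset.range c).inf (fun i => ((c.factorial / (c - i) : ℕ) : ℕ∞) * (R i).order)
        ≤ ((c.factorial / (c - 0) : ℕ) : ℕ∞) * (R 0).order := Finset.inf_le (Finset.mem_range.mpr (by omega))
      _ = ((c.factorial / c * m : ℕ) : ℕ∞) := by
          rw [Nat.sub_zero, hR0, PowerSeries.order_monomial_of_ne_zero m (1 : K) one_ne_zero, Nat.cast_mul]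
  · refine Finset.le_inf fun i hi => ?_
    rw [Finset.mem_range] at hi
    by_cases hi0 : i = 0
    · subst hi0
      rw [Nat.sub_zero, hR0, PowerSeries.order_monomial_of_ne_zero m (1 : K) one_ne_zero, Nat.cast_mul]
    · rw [hRj i (by omega), PowerSeries.order_zero, ENat.mul_top (by
        exact_mod_cast (Nat.div_pos (le_trans (Nat.sub_le c i) (Nat.self_le_factorial c)) (by omega)).ne')]
      exact le_top

omit [Fintype σ] [DecidableEq σ] [Field K] in
/-- **the monomial part drops by `c!`**: with `c = (q − d)·d`, `d < q` and `r′ + q = r + d`: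
`(c!/c)·(r′d) + c! = (c!/c)·(rd)` ("`M′^d = x^{r′d}`", "`x^{−q_𝓕}`"). [cite: HauserPerlega2024, Prop. 4 proof case (i) p. 795 l. 1–5] -/
theorem companion_monomial_add_factorial {q d r r' : ℕ} (hdq : d < q) (hd : 0 < d) (hr' : r' + q = r + d) :
    ((((q - d) * d).factorial / ((q - d) * d) * (d * r') : ℕ) : ℕ∞) + ((((q - d) * d).factorial : ℕ) : ℕ∞) =
      ((((q - d) * d).factorial / ((q - d) * d) * (d * r) : ℕ) : ℕ∞) := by
  rw [← Nat.cast_add, Nat.cast_inj]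
  set c := (q - d) * d with hc
  have hcpos : 0 < c := Nat.mul_pos (by omega) hd
  have hdiv : c.factorial / c * c = c.factorial := Nat.div_mul_cancel (Nat.dvd_factorial hcpos le_rfl)
  have hr : d * r = d * r' + c := by
    rw [hc]
    zify [hdq.le]
    have : (r : ℤ) = r' + q - d := by omega
    rw [this]; ring
  rw [hr, mul_add, hdiv]

/-- **[HP24, Prop. 4 case (i)], companion branch**: with `c = (q−d)d`, `0 < d < q`, `r′ + q = r + d`, `x^q·C′ = C(x,xy)`,
`x^r ∣ C`, `x^{r′} ∣ C′`, all monomials of `C` of degree `≥ r + d`; `G = C/x^r`, `G′ = C′/x^{r′}`, `M = x^r`, `M′ = x^{r′}`: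
`min(s_c(M′^d), s_c(G′^{q−d})) + c! = min(s_c(M^d), s_c(G^{q−d}))` — "`coeff_{q_𝓖}(M′^{d} + G′^{pᵉ−d}) =
x^{−q_𝓕}·coeff_{q_𝓕}(M^{d} + G^{pᵉ−d})` … This proves that `s_𝓖 < s_𝓕`".
[cite: HauserPerlega2024, Prop. 4 proof case (i) p. 794 l. 36 – p. 795 l. 5] -/
theorem companion_min_add_factorial_of_step (q : ℕ) (x y : σ) (hxy : x ≠ y) (hσ : ∀ l, l = x ∨ l = y)
    (C C' : MvPowerSeries σ K)
    (hC' : (MvPowerSeries.X x : MvPowerSeries σ K) ^ q * C' = MvPowerSeries.subst (fun l => if l = y then (MvPowerSeries.X x : MvPowerSeries σ K) * MvPowerSeries.X y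
        else MvPowerSeries.X l) C)
    (r r' d : ℕ) (hdq : d < q) (hd : 0 < d) (hr' : r' + q = r + d)
    (hxr : ∀ m, MvPowerSeries.coeff m C ≠ 0 → r ≤ m x) (hxr' : ∀ m, MvPowerSeries.coeff m C' ≠ 0 → r' ≤ m x)
    (hmin : ∀ m, MvPowerSeries.coeff m C ≠ 0 → r + d ≤ m x + m y)
    (RM RM' RG RG' : ℕ → PowerSeries K)
    (hRM : ∀ j v, PowerSeries.coeff v (RM j) = MvPowerSeries.coeff (Finsupp.single x v + Finsupp.single y j)
      ((MvPowerSeries.monomial (Finsupp.single x r) (1 : K)) ^ d))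
    (hRM' : ∀ j v, PowerSeries.coeff v (RM' j) = MvPowerSeries.coeff (Finsupp.single x v + Finsupp.single y j)
      ((MvPowerSeries.monomial (Finsupp.single x r') (1 : K)) ^ d))
    (hRG : ∀ j v, PowerSeries.coeff v (RG j) = MvPowerSeries.coeff (Finsupp.single x v + Finsupp.single y j)
      ((divMonomial (Finsupp.single x r) C) ^ (q - d)))
    (hRG' : ∀ j v, PowerSeries.coeff v (RG' j) = MvPowerSeries.coeff (Finsupp.single x v + Finsupp.single y j)
      ((divMonomial (Finsupp.single x r') C') ^ (q - d))) :
    min ((Finset.range ((q - d) * d)).inf (fun i => ((((q - d) * d).factorial / ((q - d) * d - i) : ℕ) : ℕ∞) * (RM' i).order))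
        ((Finset.range ((q - d) * d)).inf (fun i => ((((q - d) * d).factorial / ((q - d) * d - i) : ℕ) : ℕ∞) * (RG' i).order)) +
        ((((q - d) * d).factorial : ℕ) : ℕ∞) =
      min ((Finset.range ((q - d) * d)).inf (fun i => ((((q - d) * d).factorial / ((q - d) * d - i) : ℕ) : ℕ∞) * (RM i).order))
        ((Finset.range ((q - d) * d)).inf (fun i => ((((q - d) * d).factorial / ((q - d) * d - i) : ℕ) : ℕ∞) * (RG i).order)) := by
  classical
  set c := (q - d) * d with hc
  have hcpos : 1 ≤ c := Nat.mul_pos (by omega) hd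
  -- the monomial parts
  have hMd : (MvPowerSeries.monomial (Finsupp.single x r) (1 : K)) ^ d = MvPowerSeries.monomial (Finsupp.single x (d * r)) 1 := by
    rw [MvPowerSeries.monomial_pow, one_pow, Finsupp.smul_single, smul_eq_mul]
  have hMd' : (MvPowerSeries.monomial (Finsupp.single x r') (1 : K)) ^ d =
      MvPowerSeries.monomial (Finsupp.single x (d * r')) 1 := by
    rw [MvPowerSeries.monomial_pow, one_pow, Finsupp.smul_single, smul_eq_mul]
  have hM := inf_rows_monomial_single c (d * r) hcpos x y hxy hσ RM (fun j v => by rw [hRM, hMd])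
  have hM' := inf_rows_monomial_single c (d * r') hcpos x y hxy hσ RM' (fun j v => by rw [hRM', hMd'])
  -- the residual parts
  have hG := X_pow_mul_residual_eq_step q x y hxy C C' hC' r r' d hr' hxr hxr'
  have hGk := X_pow_mul_pow_eq_step_pow x y _ _ d (q - d) hG
  rw [show d * (q - d) = c by rw [hc, mul_comm]] at hGk
  have hminG : ∀ m, MvPowerSeries.coeff m ((divMonomial (Finsupp.single x r) C) ^ (q - d)) ≠ 0 → c ≤ m x + m y := by
    intro m hm
    have h1 : ((d : ℕ) : ℕ∞) ≤ (divMonomial (Finsupp.single x r) C).order := by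
      refine MvPowerSeries.nat_le_order fun n hn => ?_
      by_contra hne
      rw [coeff_divMonomial''] at hne
      have h2 := hmin _ hne
      rw [Finsupp.add_apply, Finsupp.add_apply, Finsupp.single_eq_same, Finsupp.single_apply, if_neg hxy] at h2
      rw [Finsupp.degree_eq_sum, sum2 hxy hσ] at hn
      have : (n x + n y : ℕ) < d := by exact_mod_cast hn
      omega
    have h3 := le_trans (le_trans (nsmul_le_nsmul_right h1 (q - d))
      (MvPowerSeries.le_order_pow (f := divMonomial (Finsupp.single x r) C) (q - d)))
      (MvPowerSeries.order_le hm)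
    rw [Finsupp.degree_eq_sum, sum2 hxy hσ, nsmul_eq_mul, ← Nat.cast_mul, Nat.cast_le] at h3
    rw [hc]
    exact h3
  have hGrows := inf_rows_add_factorial_of_step' c x y hxy hσ _ _ hGk hminG RG RG' hRG hRG'
  -- assemble
  rw [← min_add_add_right, hGrows, hM', hM, companion_monomial_add_factorial hdq hd hr']

/-- **the row law relative to a two-letter exceptional monomial** `M = x^{r_x}y^{r_y}` ("`E_a = V(xy)`", flag `F₁ = V(z,y)`,
no shift): under `x^q·C′ = C(x,xy)` and `r′_x + q = r_x + r_y + d` ("`M′(x,y) = x^{d_res−pᵉ}M(x,xy)`"), the rows of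
`C′/(x^{r′_x}y^{r_y})` are the rows of `C/(x^{r_x}y^{r_y})` shifted down by `d − i`.
[cite: HauserPerlega2024, Prop. 4 proof case (i) p. 794 l. 36–40] -/
theorem coeff_step_row_xy (q : ℕ) (x y : σ) (hxy : x ≠ y) (hσ : ∀ l, l = x ∨ l = y) (C C' : MvPowerSeries σ K)
    (hC' : (MvPowerSeries.X x : MvPowerSeries σ K) ^ q * C' = MvPowerSeries.subst (fun l => if l = y then (MvPowerSeries.X x : MvPowerSeries σ K) * MvPowerSeries.X y
        else MvPowerSeries.X l) C)
    (rx rx' ry d : ℕ) (hr' : rx' + q = rx + ry + d) (R R' : ℕ → PowerSeries K)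
    (hR : ∀ j v, PowerSeries.coeff v (R j) =
      MvPowerSeries.coeff (Finsupp.single x (rx + v) + Finsupp.single y (ry + j)) C)
    (hR' : ∀ j v, PowerSeries.coeff v (R' j) =
      MvPowerSeries.coeff (Finsupp.single x (rx' + v) + Finsupp.single y (ry + j)) C') :
    ∀ i a, i ≤ d → PowerSeries.coeff a (R' i) = PowerSeries.coeff (a + (d - i)) (R i) := by
  intro i a hid
  rw [hR', hR, coeff_eq_of_step q x y hxy hσ C C' hC', sa_l hxy, sa_r hxy, if_pos (by omega)]
  congr 2
  apply fe2 hσ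
  · rw [sa_l hxy, sa_l hxy]; omega
  · rw [sa_r hxy, sa_r hxy]

end SeriesCompanion

/-! ## B. Typed: the companion branch `0 < d_res < pᵉ` of `sValue` and Proposition 3's `s`-component there -/

section TypedCompanion

variable {σ : Type*} [Fintype σ] [DecidableEq σ] {K : Type*} [Field K]

omit [Fintype σ] in
/-- **`s_𝓕` for `0 < d_res < pᵉ`, unfolded**: `sValue = min(s_c(M^d), s_c(G^{q−d}))`, `c = (q − d)d`, as minima over the
rows of the two generators of the companion ideal. [cite: HauserPerlega2024, §5 p. 783 l. 40–48] -/
theorem sValue_eq_min_of_lt (q : ℕ) (E : Finset σ) (Φ : FlagDatum σ K) (F : MvPolynomial σ K)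
    (hd0 : 0 < dRes E F) (hdq : dRes E F < q) :
    sValue q E Φ F =
      min ((Finset.range ((q - dRes E F) * dRes E F)).inf fun i =>
          ((((q - dRes E F) * dRes E F).factorial / ((q - dRes E F) * dRes E F - i) : ℕ) : ℕ∞) *
            (PowerSeries.mk fun a => MvPowerSeries.coeff (Finsupp.single Φ.other a + Finsupp.single Φ.curve i)
              ((MvPowerSeries.monomial (excExponent E F) (1 : K)) ^ dRes E F)).order)
        ((Finset.range ((q - dRes E F) * dRes E F)).inf fun i =>
          ((((q - dRes E F) * dRes E F).factorial / ((q - dRes E F) * dRes E F - i) : ℕ) : ℕ∞) *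
            (PowerSeries.mk fun a => MvPowerSeries.coeff (Finsupp.single Φ.other a + Finsupp.single Φ.curve i)
              ((residualFlat q E Φ F) ^ (q - dRes E F))).order) := by
  unfold sValue
  dsimp only
  rw [if_neg (by omega)]
  unfold coeffIdealOrder
  rw [← Finset.inf_eq_iInf, ← Finset.inf_eq_iInf]
  congr 1
  · exact Finset.inf_congr rfl fun i _ => by rw [rowOrder_eq_order_mk]
  · exact Finset.inf_congr rfl fun i _ => by rw [rowOrder_eq_order_mk]

omit [Fintype σ] in
/-- **"`s_𝓕 ≤ ord coeff_{(pᵉ−d_res)d_res}(x^{r d_res}) = r d_res ((pᵉ − d_res)d_res − 1)!`"**: for `E = {x}` and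
`0 < d_res < pᵉ` every case-(i) flag `⟨y, x, h⟩` has `sValue ≤ (c!/c)·(d_res·r)`, `r = ord_x F`, `c = (pᵉ − d_res)d_res`.
[cite: HauserPerlega2024, Prop. 3 proof p. 792 l. 14–18] -/
theorem sValue_le_of_lt (q : ℕ) (x y : σ) (hxy : x ≠ y) (hσ : ∀ l, l = x ∨ l = y) (F : MvPolynomial σ K)
    (hd0 : 0 < dRes {x} F) (hdq : dRes {x} F < q) (h : PowerSeries K) :
    sValue q {x} ⟨y, x, h⟩ F ≤
      ((((q - dRes {x} F) * dRes {x} F).factorial / ((q - dRes {x} F) * dRes {x} F) * (dRes {x} F * ordVar F x) : ℕ) :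
        ℕ∞) := by
  classical
  have hr : excExponent ({x} : Finset σ) F = Finsupp.single x (ordVar F x) := by
    unfold excExponent; rw [Finset.sum_singleton]
  have hMd : (MvPowerSeries.monomial (excExponent ({x} : Finset σ) F) (1 : K)) ^ dRes {x} F =
      MvPowerSeries.monomial (Finsupp.single x (dRes {x} F * ordVar F x)) 1 := by
    rw [hr, MvPowerSeries.monomial_pow, one_pow, Finsupp.smul_single, smul_eq_mul]
  rw [sValue_eq_min_of_lt q {x} ⟨y, x, h⟩ F hd0 hdq]
  refine le_trans (min_le_left _ _) (le_of_eq ?_)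
  refine inf_rows_monomial_single _ _ (Nat.mul_pos (by omega) hd0) x y hxy hσ _ fun j v => ?_
  rw [PowerSeries.coeff_mk, hMd]

omit [Fintype σ] in
/-- **[HP24, Proposition 3], `s`-component, companion branch** (typed): for `E = {x}` and `0 < d_res < pᵉ` the numerals
`sValue q {x} ⟨y, x, h⟩ F` of the case-(i) flags are bounded by the monomial generator `x^{r d_res}` of the companion
ideal, hence one of them is GREATEST, and it is FINITE — "the flag invariant has to be bounded. Hence, there is a
maximizing flag" (no use of Lemma 3 in this branch). [cite: HauserPerlega2024, Prop. 3 proof p. 792 l. 14–18] -/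
theorem exists_isGreatest_sValue_of_lt (q : ℕ) (x y : σ) (hxy : x ≠ y) (hσ : ∀ l, l = x ∨ l = y)
    (F : MvPolynomial σ K) (hd0 : 0 < dRes {x} F) (hdq : dRes {x} F < q) :
    ∃ h : PowerSeries K, PowerSeries.constantCoeff h = 0 ∧ sValue q {x} ⟨y, x, h⟩ F < ⊤ ∧
      ∀ h' : PowerSeries K, PowerSeries.constantCoeff h' = 0 →
        sValue q {x} ⟨y, x, h'⟩ F ≤ sValue q {x} ⟨y, x, h⟩ F := by
  classical
  set B : ℕ := ((q - dRes {x} F) * dRes {x} F).factorial / ((q - dRes {x} F) * dRes {x} F) *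
    (dRes {x} F * ordVar F x) with hB
  have hle : ∀ h : PowerSeries K, sValue q {x} ⟨y, x, h⟩ F ≤ (B : ℕ∞) := fun h =>
    sValue_le_of_lt q x y hxy hσ F hd0 hdq h
  have hfin : ∀ h : PowerSeries K, sValue q {x} ⟨y, x, h⟩ F ≠ ⊤ := fun h =>
    ne_top_of_le_ne_top (WithTop.natCast_ne_top B) (hle h)
  set T : Set ℕ := {n | ∃ h : PowerSeries K, PowerSeries.constantCoeff h = 0 ∧ sValue q {x} ⟨y, x, h⟩ F = n} with hT
  have h00 : PowerSeries.constantCoeff (0 : PowerSeries K) = 0 := map_zero _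
  have hT0 : (sValue q {x} ⟨y, x, 0⟩ F).toNat ∈ T := ⟨0, h00, (ENat.coe_toNat (hfin 0)).symm⟩
  have hbdd : BddAbove T := by
    refine ⟨B, fun n hn => ?_⟩
    obtain ⟨h, -, hn⟩ := hn
    have h1 := hle h
    rw [hn] at h1
    exact_mod_cast h1
  obtain ⟨h, hh, hsh⟩ := Nat.sSup_mem ⟨_, hT0⟩ hbdd
  refine ⟨h, hh, by rw [hsh]; exact WithTop.coe_lt_top _, fun h' hh' => ?_⟩
  have h1 : sValue q {x} ⟨y, x, h'⟩ F = ((sValue q {x} ⟨y, x, h'⟩ F).toNat : ℕ∞) := (ENat.coe_toNat (hfin h')).symm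
  rw [h1, hsh]
  exact_mod_cast le_csSup hbdd ⟨h', hh', h1⟩

end TypedCompanion

end HauserPerlega2024

end Literature.AlgebraicGeometry.Resolution
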